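import Summits.BirchSwinnertonDyer.BirchSwinnertonDyer.Theorems.ManinLocalTwoThreePShiftDescentExtend
import HarnessLib

/-!
# The prime-generic descent engine, VI: descent of an ABSTRACT compatible pair `Γ₀(p²m) ⇝ Γ₀(pm)`
# (route `ManinLocalTwoThree`, cell bsd-f2-manin; cruxes C2 stmt-BirchSwinnertonDyer-22967 / C3 stmt-…-22968; LEAD seat p1 gen 12)

Files I–II (`…PShiftDescentEngine`, `…PShiftDescentExtend`) glue the SPECIFIC pair `(coshift φ ε, restr φ)` of an eigenfunction `φ`.  The
eigenvalue-`≠ 1` step of the eigen law (file VII, es's «two functionals and one explicit pair», MEMO-es §37.13 (B)) needs the same engine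
for a MIXED pair.  This file records the abstract form: for `α, β : Γ₀(pm) → K` with `α` additive on `A = {p ∣ b}` (`stabZero`), `β` additive
on `B = {p²m ∣ c}` (`subB`), `α = β` on `A ∩ B`, and the single `κ`-condition `α(T Q₁ T⁻¹) = α(Q₁)`, there is an additive `w` on `Γ₀(pm)` with
`w = α` on `A` and `w = β` on `B` (**`descentPair`**; every prime `p`, every `m ≥ 1`, any commutative ring `K`).  Proof = files I–II verbatim
with the pair abstracted: glue on `G₁ = {a² ≡ 1}` along `T` (`PShiftGlue.glueOn`), `D`-invariance by uniqueness, extension along `D`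
(`PShiftGlue.glueExtend`).  Nothing about BSD, Manin's conjecture or C2/C3 is asserted here.
[cite: DarmonDiamondTaylor1995, Lemma 4.28 (p. 135) (shape only)]
-/

set_option autoImplicit false
set_option linter.dupNamespace false

open scoped MatrixGroups

open CongruenceSubgroup Matrix.SpecialLinearGroup
  Summit.BirchSwinnertonDyer.Rank1Residual.ManinAdditive.NineShiftEqualiser

namespace Summit.BirchSwinnertonDyer.BirchSwinnertonDyer.Theorems.ManinLocalTwoThree

namespace PShiftEngine

open ThreeShiftDescent TwoShift PShiftTransfer PShiftGlue

variable {p : ℕ} [Fact p.Prime] {K : Type*} [CommRing K] {m : ℕ} (α β : Gamma0 (p * m) → K)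

/-- **DESCENT OF AN ABSTRACT COMPATIBLE PAIR** (every prime `p`, every `m ≥ 1`, any `K`): `α` additive on `A = {p ∣ b}`, `β` additive on
`B = {p²m ∣ c}`, `α = β` on `A ∩ B`, `α(T Q₁ T⁻¹) = α(Q₁)` ⟹ an additive `w : Γ₀(pm) → K` with `w = α` on `A` and `w = β` on `B`.
Proof: `W(g) := α(g T^{−a_g b_g}) + (a_g b_g)·β(T)` is additive on `G₁` (`PShiftGlue.glueOn` + `conj_invariant_of_generator`), `D`-invariant by
uniqueness (`eq_zero_on_subG1`), and `w(d·x) := α(d) + W(x)` along `G = D·G₁` (`PShiftGlue.glueExtend`). [new: files I–II with the pair abstracted] -/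
theorem descentPair (hm : 0 < m)
    (hα : ∀ x ∈ stabZero p (p * m), ∀ y ∈ stabZero p (p * m), α (x * y) = α x + α y)
    (hβ : ∀ x ∈ subB p m, ∀ y ∈ subB p m, β (x * y) = β x + β y)
    (hC : ∀ x ∈ stabZero p (p * m), x ∈ subB p m → α x = β x)
    (hκ : α (Tpow (p * m) 1 * Q1 p m * (Tpow (p * m) 1)⁻¹) = α (Q1 p m)) :
    ∃ w : Gamma0 (p * m) → K, IsAdd w ∧ (∀ x ∈ stabZero p (p * m), w x = α x) ∧ (∀ x ∈ subB p m, w x = β x) := by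
  have hAn := subA1_normal (p := p) (m := m)
  have hGn := subG1_normal (p := p) (m := m)
  -- §1 glue on `G₁`
  have hα' : ∀ x ∈ subA1 p m, ∀ y ∈ subA1 p m, α (x * y) = α x + α y :=
    fun x hx y hy => hα x (stabZero_of_subA1 hx) y (stabZero_of_subA1 hy)
  have hC' : ∀ x ∈ subA1 p m, x ∈ subB p m → α x = β x := fun x hx hxB => hC x (stabZero_of_subA1 hx) hxB
  have ht : Tpow (p * m) 1 ∈ subB p m := Tpow_mem_subB 1
  have hinvT := conj_invariant_of_generator hAn hα' hβ hC' ht Q1_mem_subA1 (exists_mul_Q1_zpow_mem_subB) hκ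
  obtain ⟨hW, hWA, hWB⟩ := glueOn (fun g _ a ha => hAn.conj_mem a ha g) hα' hβ hC' ht (Tpow_mem_subG1 1) hinvT
    (fun g => ((g : SL(2, ℤ)) 0 0 : ℤ) * (g : SL(2, ℤ)) 0 1) mul_Tpow_neg_mem_subA1 Tpow_n_mem_subA1
  set W : Gamma0 (p * m) → K := fun g => α (g * Tpow (p * m) 1 ^ (-(((g : SL(2, ℤ)) 0 0 : ℤ) * (g : SL(2, ℤ)) 0 1)))
    + (((g : SL(2, ℤ)) 0 0 : ℤ) * (g : SL(2, ℤ)) 0 1) • β (Tpow (p * m) 1) with hWdef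
  change ∀ g ∈ subG1 p m, ∀ h ∈ subG1 p m, W (g * h) = W g + W h at hW
  change ∀ a ∈ subA1 p m, W a = α a at hWA
  change ∀ b ∈ subB p m, b ∈ subG1 p m → W b = β b at hWB
  -- §2 `D`-invariance of `W` on `G₁` (uniqueness)
  have hconj : ∀ d ∈ subD p m, ∀ x ∈ subG1 p m, W (d * x * d⁻¹) = W x := by
    intro d hd x hx
    obtain ⟨hd0, hdB⟩ := mem_subD.mp hd
    have key := eq_zero_on_subG1 (u := fun y => W (d * y * d⁻¹) - W y)
      (fun g hg h hh => by
        show W (d * (g * h) * d⁻¹) - W (g * h) = (W (d * g * d⁻¹) - W g) + (W (d * h * d⁻¹) - W h)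
        have e : d * (g * h) * d⁻¹ = (d * g * d⁻¹) * (d * h * d⁻¹) := by group
        rw [e, hW _ (hGn.conj_mem g hg d) _ (hGn.conj_mem h hh d), hW _ hg _ hh]
        ring)
      (fun a ha => by
        show W (d * a * d⁻¹) - W a = 0
        rw [hWA _ (hAn.conj_mem a ha d), hWA _ ha,
          hα _ ((stabZero p (p * m)).mul_mem hd0 (stabZero_of_subA1 ha)) _ ((stabZero p (p * m)).inv_mem hd0),
          hα _ hd0 _ (stabZero_of_subA1 ha), addOn_map_inv hα hd0]
        ring)
      (fun b hb hbG => by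
        show W (d * b * d⁻¹) - W b = 0
        have hbdB : d * b * d⁻¹ ∈ subB p m := (subB p m).mul_mem ((subB p m).mul_mem hdB hb) ((subB p m).inv_mem hdB)
        rw [hWB _ hbdB (hGn.conj_mem b hbG d), hWB _ hb hbG, hβ _ ((subB p m).mul_mem hdB hb) _ ((subB p m).inv_mem hdB),
          hβ _ hdB _ hb, addOn_map_inv hβ hdB]
        ring)
      x hx
    exact sub_eq_zero.mp key
  -- §3 extension along `D`
  obtain ⟨hadd, hval⟩ := glueExtend (N := subG1 p m) (D := subD p m) (w₁ := W) (α := α)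
    (fun d _ x hx => hGn.conj_mem x hx d) hW hconj
    (fun x hx y hy => hα x (mem_subD.mp hx).1 y (mem_subD.mp hy).1)
    (fun x hx hxG => (hWA x ⟨hxG, (ent_eq_zero_iff _ 0 1).mpr (mem_stabZero_iff.mp (mem_subD.mp hx).1)⟩).symm)
    (dec (p := p) hm) (dec_spec hm)
  refine ⟨fun g => α (dec (p := p) hm g).1 + W (dec (p := p) hm g).2, fun g g' => hadd g g', ?_, ?_⟩
  · intro y hy
    obtain ⟨d, x, hd, hx, rfl⟩ := exists_subD_mul_subG1 (p := p) hm y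
    have hd0 := (mem_subD.mp hd).1
    have hx0 : x ∈ stabZero p (p * m) := by
      have : x = d⁻¹ * (d * x) := by group
      rw [this]; exact (stabZero p (p * m)).mul_mem ((stabZero p (p * m)).inv_mem hd0) hy
    have hxA : x ∈ subA1 p m := ⟨hx, (ent_eq_zero_iff _ 0 1).mpr (mem_stabZero_iff.mp hx0)⟩
    show α (dec (p := p) hm (d * x)).1 + W (dec (p := p) hm (d * x)).2 = α (d * x)
    rw [hval d hd x hx, hWA x hxA, hα d hd0 x hx0]
  · intro b hb
    obtain ⟨d, x, hd, hx, rfl⟩ := exists_subD_mul_subG1 (p := p) hm b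
    obtain ⟨hd0, hdB⟩ := mem_subD.mp hd
    have hxB : x ∈ subB p m := by
      have : x = d⁻¹ * (d * x) := by group
      rw [this]; exact (subB p m).mul_mem ((subB p m).inv_mem hdB) hb
    show α (dec (p := p) hm (d * x)).1 + W (dec (p := p) hm (d * x)).2 = β (d * x)
    rw [hval d hd x hx, hWB x hxB hx, hC d hd0 hdB, hβ d hdB x hxB]

end PShiftEngine

end Summit.BirchSwinnertonDyer.BirchSwinnertonDyer.Theorems.ManinLocalTwoThree
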